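import Summits.BirchSwinnertonDyer.Rank1Residual.GaloisImage.FormalGroupLocalDivisibilityRat
import HarnessLib

/-!
# Crux `MultLower` (item 19359), cell (M): option (a) of the witness road AT the place `p` from a
# prime-to-`p` MULTIPLE of the witness in the depth-2 formal group (Bezout)

Cell `bsd-addord`, seat `bsd-addord-k1-c4` (D-0074 row B3), gen 5; sibling of
`AdditiveBranchIMCMultLowerCompanion[Doors].lean`. THEOREMS ONLY (one lemma; no definition, no named fact, no `sorry`);
nothing booked. HONEST FRAMING as in the sibling files: a per-pair tool, no class statement.

## Why

The (M) companion door frees the additive place `p` by kind (iii′) when the partner `F` is ALSO potentially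
multiplicative at `p`. When `F` is of another type at `p` (the 24 rows of k1-c2 g3's census j253895 whose only
rank-2 congruent partner is of type (G-ord), 2 rows with a type-IV partner), Mazur–Rubin's Case 4 does not apply
(types differ), but option (a) does: it suffices that the witness `T` be `p`-DIVISIBLE in `F(ℚ_p)`. The tree's
`LocalDivisibility.exists_nsmul_eq_baseChange_of_dvd_den` (n1011-p09) gives this at `ℓ = p` from the depth-2 test
`p ∣ den x(T)`, `p² ∣ num(x/y)(T)` (`F̂(p²ℤ_p) ⊆ p·F̂(pℤ_p)`, Silverman IV.6.4), but only for `T` itself; the witness road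
needs it for a prime-to-`p` multiple `m·T` (the prime-to-`p` part of `[F(ℚ_p) : F₁(ℚ_p)]`, here the Tamagawa factor
`c_p ∈ {1,2,3,4}` of an additive fibre), followed by Bezout — exactly as team b2b's
`Supersingular.exists_nsmul_eq_baseChange_of_nsmul_dvd_den` does at `ℓ ≠ p`. This file is that lemma with `ℓ = p`
allowed. Census kit j262026 (this gen): with coefficients mod `p²` ALL 26 such rows have a witness `T = aP₁ + bP₂`
and a multiple `m ∣ 12` passing the depth-2 test at `p = 5`.

References: Silverman AEC Thm. IV.6.4, Prop. VII.2.2 [SilvermanAEC2009]; Cremona–Mazur 2000 §3 [CremonaMazur2000].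
-/

set_option autoImplicit false

noncomputable section

open scoped Classical

open WeierstrassCurve NumberField IsDedekindDomain Rat.HeightOneSpectrum
  Summit.BirchSwinnertonDyer.Rank1Residual.GaloisImage

set_option linter.dupNamespace false

namespace Summit.BirchSwinnertonDyer.BirchSwinnertonDyer.Theorems.AdditiveBranchIMCMultLowerCompanion

/-- **Local `p`-divisibility from a prime-to-`p` multiple in the formal group, the place `ℓ = p` ALLOWED
(depth 2).** `W = ⟨a₁, …, a₆⟩` (`aᵢ ∈ ℤ`) elliptic over `ℚ`, `p` an odd prime, `ℓ` a prime, `v` the place over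
`ℓ`, `P = (x, y) ∈ E(ℚ)` and `m` prime to `p` with `m • P = (x', y')`, `ℓ ∣ den x'` and, if `ℓ = p`,
`p² ∣ num (x'/y')` (i.e. `m·P ∈ Ê(p²ℤ_p) ⊆ p·E₁(ℚ_p)`): then `P|_{ℚ_v} = p • Q` for some `Q ∈ E(ℚ_v)`. Indeed
`m·P = p·Q'` in `E(ℚ_v)` by n1011-p09's `LocalDivisibility.exists_nsmul_eq_baseChange_of_dvd_den` and
`am + bp = 1` gives `P = p·(aQ' + bP)` (the Bezout step of b2b's
`Supersingular.exists_nsmul_eq_baseChange_of_nsmul_dvd_den`, verbatim). Option (a) of the witness road at a place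
where the image of the witness in `E(ℚ_v)/Ê(p²)` has order prime to `p` — in particular at the ADDITIVE place `p`
of a partner of any reduction type. [cite: SilvermanAEC2009, Thm. IV.6.4 and Prop. VII.2.2] [cite: CremonaMazur2000, §3] -/
theorem exists_nsmul_eq_baseChange_of_nsmul_dvd_den_depth (a₁ a₂ a₃ a₄ a₆ : ℤ) (W : WeierstrassCurve ℚ)
    [W.IsElliptic] (hW : W = ⟨a₁, a₂, a₃, a₄, a₆⟩) {p ℓ : ℕ} [hp : Fact p.Prime] [Fact ℓ.Prime]
    (hp2 : p ≠ 2) {v : HeightOneSpectrum (𝓞 ℚ)} (hv : (primesEquiv v : ℕ) = ℓ) {x y : ℚ}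
    (h : W.toAffine.Nonsingular x y) {m : ℕ} (hm : m.Coprime p) {x' y' : ℚ} (h' : W.toAffine.Nonsingular x' y')
    (hmul : m • (Affine.Point.some x y h : W.toAffine.Point) = .some x' y' h') (hx' : ℓ ∣ x'.den)
    (hz : ℓ = p → (p : ℤ) ^ 2 ∣ (x' / y').num) :
    ∃ Q : (W.baseChange (v.adicCompletion ℚ)).toAffine.Point,
      p • Q = WeierstrassCurve.Affine.Point.baseChange (W' := W) ℚ (v.adicCompletion ℚ) (.some x y h) := by
  obtain ⟨Q', hQ'⟩ := LocalDivisibility.exists_nsmul_eq_baseChange_of_dvd_den a₁ a₂ a₃ a₄ a₆ W hW hp2 hv h' hx' hz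
  set Pw := WeierstrassCurve.Affine.Point.baseChange (W' := W) ℚ (v.adicCompletion ℚ) (.some x y h) with hPw
  have hmPw : WeierstrassCurve.Affine.Point.baseChange (W' := W) ℚ (v.adicCompletion ℚ) (.some x' y' h') = m • Pw := by
    rw [hPw, ← map_nsmul]; exact congrArg _ hmul.symm
  have hQm : (p : ℤ) • Q' = (m : ℤ) • Pw := by
    rw [natCast_zsmul, natCast_zsmul, hQ', hmPw]
  obtain ⟨a, b, hab⟩ : IsCoprime (m : ℤ) (p : ℤ) := Nat.isCoprime_iff_coprime.mpr hm
  refine ⟨a • Q' + b • Pw, ?_⟩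
  rw [← natCast_zsmul, smul_add, smul_comm (p : ℤ) a Q', hQm, smul_smul, smul_smul, ← add_smul,
    show a * (m : ℤ) + (p : ℤ) * b = 1 by linear_combination hab, one_smul]

end Summit.BirchSwinnertonDyer.BirchSwinnertonDyer.Theorems.AdditiveBranchIMCMultLowerCompanion

end
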